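import Mathlib
import HarnessLib
import Summits.RiemannHypothesis.Statement
import Summits.RiemannHypothesis.RiemannHypothesis.Theses.MayerPairing
import Summits.RiemannHypothesis.RiemannHypothesis.Theorems.MayerPairingNontrivialZeroLocus

/-!
# RiemannHypothesis / MayerPairing — which weakenings of the monotonicity crux still close

Route `RiemannHypothesis/MayerPairing`, item stmt-RiemannHypothesis-1473 (`Target =
UnitCircleCrossedOnce ∧ BranchPairing`), helper file (supports 1473).

Context. The monotonicity crux `UnitCircleCrossedOnce` (item 1470: no continuous eigenvalue
selection `σ ↦ Λ σ` of Mayer's `L_{σ+iτ}`, `|τ| ≥ 7`, has modulus `1` at both ends of an interval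
`[a, b] ⊂ (0, 1/2)`) is numerically violated (evidence on items 1470/1473: double unit-circle
crossings of one branch at `τ ≈ 24.00` and at `τ ≈ 37.85`). The route's deciding theorem `closes`,
however, uses the crux only in a much weaker configuration: the interval is SYMMETRIC about
`σ = 1/4` (`a + b = 1/2`, forced by the functional equation `ρ ↦ 1 - ρ̄`) and the selection takes the
exact VALUE `1` at both ends (forced by `BranchPairing`). This file records, kernel-checked and
Mathlib-only, the lattice of intermediate hypotheses, each stated inline (no new definitions):

* `mayerPairing_riemannHypothesis_of_symmetricEndpointOne` — the weakest form
  W4sym `¬ (Λ a = 1 ∧ Λ b = 1)` on symmetric intervals `a + b = 1/2` already gives, with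
  `BranchPairing`, the Riemann Hypothesis (the zero-locus bookkeeping is in tree);
* `mayerPairing_symmetricEndpointOne_of_symmetricModulus` — the symmetric-interval MODULUS form
  W2 `¬ (‖Λ a‖ = 1 ∧ ‖Λ b‖ = 1)` for `a + b = 1/2` implies W4sym;
* `mayerPairing_symmetricEndpointOne_of_exactLeft` — the mixed form
  W1 `¬ (Λ a = 1 ∧ ‖Λ b‖ = 1)` for all `0 < a < b < 1/2` implies W4sym;
* `mayerPairing_symmetricModulus_of_unitCircleCrossedOnce`,
  `mayerPairing_exactLeft_of_unitCircleCrossedOnce` — both are weakenings of the filed crux;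
* `mayerPairing_riemannHypothesis_of_symmetricModulus`,
  `mayerPairing_riemannHypothesis_of_exactLeft` — hence each of W1, W2 closes the route with
  `BranchPairing`.

So a numerical witness against `UnitCircleCrossedOnce` refutes the route's thesis as filed but not
the assembly mechanism unless it is symmetric (`a + b = 1/2`) or starts at the exact eigenvalue `1`;
the numerical status of W1/W2 is recorded on the items, not here.

References: D. Mayer, Bull. AMS 25 (1991) 55–60, Thm 2; I. Efrat, Invent. Math. 114 (1993)
207–218; C.-H. Chang and D. Mayer, Contemp. Math. 290 (2001), Prop. 4.1(v).
-/

namespace Summit.RiemannHypothesis.RiemannHypothesis.Theorems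

open Filter Topology
open Summit.RiemannHypothesis.RiemannHypothesis.Theses.MayerPairing

/-- **The weakest form of the monotonicity crux that closes the route.** Suppose that for every
height `|τ| ≥ 7` and every interval `[a, b]` symmetric about `1/4` (`0 < a < b`, `a + b = 1/2`), no
continuous selection `Λ` of eigenvalues of Mayer's `L_{σ+iτ}` on `[a, b]` (inlined
functional-equation predicate) takes the value `1` at both `a` and `b` (form W4sym). Then
`BranchPairing` implies the Riemann Hypothesis: a zero `ρ` with `0 < Re ρ < 1/2`, `Im ρ > 14`
would give such a selection on `[Re ρ/2, (1 - Re ρ)/2]` at height `Im ρ/2 ≥ 7`; zeros are moved into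
the quarter `0 < Re ρ ≤ 1/2`, `Im ρ > 14` by `s ↦ 1 - s` and conjugation, using the in-tree
bookkeeping `mayerPairing_nontrivialZeroLocus`. (Same skeleton as the route's `closes`.) [folklore] -/
theorem mayerPairing_riemannHypothesis_of_symmetricEndpointOne
    (hW : ∀ τ : ℝ, 7 ≤ |τ| → ∀ a b : ℝ, 0 < a → a < b → a + b = 1 / 2 → ∀ Λ : ℝ → ℂ,
      ContinuousOn Λ (Set.Icc a b) →
      (∀ σ ∈ Set.Icc a b, ∃ f : ℂ → ℂ, ∃ δ : ℝ, 0 < δ ∧ DifferentiableOn ℂ f {z : ℂ | -δ < z.re} ∧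
        (∃ z : ℂ, 0 < z.re ∧ f z ≠ 0) ∧
        (∀ z : ℂ, -δ < z.re → Λ σ * (f z - f (z + 1)) =
          (z + 1) ^ (-(2 * ((σ : ℂ) + (τ : ℂ) * Complex.I))) * f (1 / (z + 1))) ∧
        Tendsto (fun x : ℝ => Λ σ * f x -
          f 0 * ((x : ℂ) + 1) ^ (1 - 2 * ((σ : ℂ) + (τ : ℂ) * Complex.I)) /
          (2 * ((σ : ℂ) + (τ : ℂ) * Complex.I) - 1)) atTop (𝓝 0)) →
      ¬ (Λ a = 1 ∧ Λ b = 1))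
    (hB : BranchPairing) : _root_.Summit.RiemannHypothesis := by
  -- the core step: a zero in the closed left half of the upper critical strip lies on the line
  have key : ∀ ρ : ℂ, riemannZeta ρ = 0 → 0 < ρ.re → ρ.re ≤ 1 / 2 → 14 < ρ.im → ρ.re = 1 / 2 := by
    intro ρ hρ h0 hhalf h14
    by_contra hne
    have hlt : ρ.re < 1 / 2 := lt_of_le_of_ne hhalf hne
    obtain ⟨Λ, hcont, ha, hb, heig⟩ := hB ρ hρ h0 hhalf h14
    have hτpos : 0 < ρ.im / 2 := by linarith
    have hτ : (7 : ℝ) ≤ |ρ.im / 2| := by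
      rw [abs_of_pos hτpos]
      linarith
    exact hW (ρ.im / 2) hτ (ρ.re / 2) ((1 - ρ.re) / 2) (by linarith) (by linarith) (by ring)
      Λ hcont heig ⟨ha, hb⟩
  -- conjugation symmetry: reduce `14 < |im ρ|` to `14 < im ρ`
  have lift : ∀ ρ : ℂ, riemannZeta ρ = 0 → 0 < ρ.re → ρ.re ≤ 1 / 2 → 14 < |ρ.im| →
      ρ.re = 1 / 2 := by
    intro ρ hρ h0 hhalf h14
    rcases lt_or_ge 0 ρ.im with hpos | hnonpos
    · exact key ρ hρ h0 hhalf (by rwa [abs_of_pos hpos] at h14)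
    · have hconj : riemannZeta (starRingEnd ℂ ρ) = 0 := by
        rw [riemannZeta_conj, hρ]
        simp
      have h14' : 14 < (starRingEnd ℂ ρ).im := by
        rw [Complex.conj_im]
        rwa [abs_of_nonpos hnonpos] at h14
      have h0' : 0 < (starRingEnd ℂ ρ).re := by rwa [Complex.conj_re]
      have hhalf' : (starRingEnd ℂ ρ).re ≤ 1 / 2 := by rwa [Complex.conj_re]
      have := key (starRingEnd ℂ ρ) hconj h0' hhalf' h14'
      rwa [Complex.conj_re] at this
  -- the statement itself
  intro s hs htriv h1
  obtain ⟨hre0, hre1, him⟩ := mayerPairing_nontrivialZeroLocus s hs htriv h1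
  rcases le_or_gt s.re (1 / 2) with hle | hgt
  · exact lift s hs hre0 hle him
  · -- functional equation: pass to the zero `1 - s`
    have hnat : ∀ n : ℕ, s ≠ -(n : ℂ) := by
      intro n h
      have hre : s.re = -(n : ℝ) := by
        rw [h, Complex.neg_re, Complex.natCast_re]
      have hn : (0 : ℝ) ≤ n := n.cast_nonneg
      linarith
    have hsub : riemannZeta (1 - s) = 0 := by
      rw [riemannZeta_one_sub hnat h1, hs, mul_zero]
    have h0' : 0 < (1 - s).re := by
      rw [Complex.sub_re, Complex.one_re]
      linarith
    have hhalf' : (1 - s).re ≤ 1 / 2 := by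
      rw [Complex.sub_re, Complex.one_re]
      linarith
    have him' : 14 < |(1 - s).im| := by
      rw [Complex.sub_im, Complex.one_im, zero_sub, abs_neg]
      exact him
    have h := lift (1 - s) hsub h0' hhalf' him'
    rw [Complex.sub_re, Complex.one_re] at h
    linarith

/-- **Symmetric-interval modulus form ⇒ endpoint form.** If on symmetric intervals (`a + b = 1/2`)
no continuous eigenvalue selection has MODULUS `1` at both ends (form W2), then a fortiori none
takes the value `1` at both ends (form W4sym). [folklore] -/
theorem mayerPairing_symmetricEndpointOne_of_symmetricModulus
    (h : ∀ τ : ℝ, 7 ≤ |τ| → ∀ a b : ℝ, 0 < a → a < b → a + b = 1 / 2 → ∀ Λ : ℝ → ℂ,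
      ContinuousOn Λ (Set.Icc a b) →
      (∀ σ ∈ Set.Icc a b, ∃ f : ℂ → ℂ, ∃ δ : ℝ, 0 < δ ∧ DifferentiableOn ℂ f {z : ℂ | -δ < z.re} ∧
        (∃ z : ℂ, 0 < z.re ∧ f z ≠ 0) ∧
        (∀ z : ℂ, -δ < z.re → Λ σ * (f z - f (z + 1)) =
          (z + 1) ^ (-(2 * ((σ : ℂ) + (τ : ℂ) * Complex.I))) * f (1 / (z + 1))) ∧
        Tendsto (fun x : ℝ => Λ σ * f x -
          f 0 * ((x : ℂ) + 1) ^ (1 - 2 * ((σ : ℂ) + (τ : ℂ) * Complex.I)) /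
          (2 * ((σ : ℂ) + (τ : ℂ) * Complex.I) - 1)) atTop (𝓝 0)) →
      ¬ (‖Λ a‖ = 1 ∧ ‖Λ b‖ = 1)) :
    ∀ τ : ℝ, 7 ≤ |τ| → ∀ a b : ℝ, 0 < a → a < b → a + b = 1 / 2 → ∀ Λ : ℝ → ℂ,
      ContinuousOn Λ (Set.Icc a b) →
      (∀ σ ∈ Set.Icc a b, ∃ f : ℂ → ℂ, ∃ δ : ℝ, 0 < δ ∧ DifferentiableOn ℂ f {z : ℂ | -δ < z.re} ∧
        (∃ z : ℂ, 0 < z.re ∧ f z ≠ 0) ∧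
        (∀ z : ℂ, -δ < z.re → Λ σ * (f z - f (z + 1)) =
          (z + 1) ^ (-(2 * ((σ : ℂ) + (τ : ℂ) * Complex.I))) * f (1 / (z + 1))) ∧
        Tendsto (fun x : ℝ => Λ σ * f x -
          f 0 * ((x : ℂ) + 1) ^ (1 - 2 * ((σ : ℂ) + (τ : ℂ) * Complex.I)) /
          (2 * ((σ : ℂ) + (τ : ℂ) * Complex.I) - 1)) atTop (𝓝 0)) →
      ¬ (Λ a = 1 ∧ Λ b = 1) := by
  intro τ hτ a b ha hab hsum Λ hΛ heig hone
  exact h τ hτ a b ha hab hsum Λ hΛ heig ⟨by rw [hone.1, norm_one], by rw [hone.2, norm_one]⟩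

/-- **Mixed form ⇒ endpoint form.** If no continuous eigenvalue selection on any
`[a, b] ⊂ (0, 1/2)` starts at the exact eigenvalue `1` at `a` and reaches MODULUS `1` at `b`
(form W1: "the branch through the eigenvalue `1` does not return to the unit circle further right"),
then the symmetric endpoint form W4sym holds. [folklore] -/
theorem mayerPairing_symmetricEndpointOne_of_exactLeft
    (h : ∀ τ : ℝ, 7 ≤ |τ| → ∀ a b : ℝ, 0 < a → a < b → b < 1 / 2 → ∀ Λ : ℝ → ℂ,
      ContinuousOn Λ (Set.Icc a b) →
      (∀ σ ∈ Set.Icc a b, ∃ f : ℂ → ℂ, ∃ δ : ℝ, 0 < δ ∧ DifferentiableOn ℂ f {z : ℂ | -δ < z.re} ∧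
        (∃ z : ℂ, 0 < z.re ∧ f z ≠ 0) ∧
        (∀ z : ℂ, -δ < z.re → Λ σ * (f z - f (z + 1)) =
          (z + 1) ^ (-(2 * ((σ : ℂ) + (τ : ℂ) * Complex.I))) * f (1 / (z + 1))) ∧
        Tendsto (fun x : ℝ => Λ σ * f x -
          f 0 * ((x : ℂ) + 1) ^ (1 - 2 * ((σ : ℂ) + (τ : ℂ) * Complex.I)) /
          (2 * ((σ : ℂ) + (τ : ℂ) * Complex.I) - 1)) atTop (𝓝 0)) →
      ¬ (Λ a = 1 ∧ ‖Λ b‖ = 1)) :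
    ∀ τ : ℝ, 7 ≤ |τ| → ∀ a b : ℝ, 0 < a → a < b → a + b = 1 / 2 → ∀ Λ : ℝ → ℂ,
      ContinuousOn Λ (Set.Icc a b) →
      (∀ σ ∈ Set.Icc a b, ∃ f : ℂ → ℂ, ∃ δ : ℝ, 0 < δ ∧ DifferentiableOn ℂ f {z : ℂ | -δ < z.re} ∧
        (∃ z : ℂ, 0 < z.re ∧ f z ≠ 0) ∧
        (∀ z : ℂ, -δ < z.re → Λ σ * (f z - f (z + 1)) =
          (z + 1) ^ (-(2 * ((σ : ℂ) + (τ : ℂ) * Complex.I))) * f (1 / (z + 1))) ∧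
        Tendsto (fun x : ℝ => Λ σ * f x -
          f 0 * ((x : ℂ) + 1) ^ (1 - 2 * ((σ : ℂ) + (τ : ℂ) * Complex.I)) /
          (2 * ((σ : ℂ) + (τ : ℂ) * Complex.I) - 1)) atTop (𝓝 0)) →
      ¬ (Λ a = 1 ∧ Λ b = 1) := by
  intro τ hτ a b ha hab hsum Λ hΛ heig hone
  exact h τ hτ a b ha hab (by linarith) Λ hΛ heig ⟨hone.1, by rw [hone.2, norm_one]⟩

/-- The filed crux `UnitCircleCrossedOnce` implies its symmetric-interval modulus form W2
(restrict to `a + b = 1/2`, whence `b < 1/2`). [folklore] -/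
theorem mayerPairing_symmetricModulus_of_unitCircleCrossedOnce (hU : UnitCircleCrossedOnce) :
    ∀ τ : ℝ, 7 ≤ |τ| → ∀ a b : ℝ, 0 < a → a < b → a + b = 1 / 2 → ∀ Λ : ℝ → ℂ,
      ContinuousOn Λ (Set.Icc a b) →
      (∀ σ ∈ Set.Icc a b, ∃ f : ℂ → ℂ, ∃ δ : ℝ, 0 < δ ∧ DifferentiableOn ℂ f {z : ℂ | -δ < z.re} ∧
        (∃ z : ℂ, 0 < z.re ∧ f z ≠ 0) ∧
        (∀ z : ℂ, -δ < z.re → Λ σ * (f z - f (z + 1)) =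
          (z + 1) ^ (-(2 * ((σ : ℂ) + (τ : ℂ) * Complex.I))) * f (1 / (z + 1))) ∧
        Tendsto (fun x : ℝ => Λ σ * f x -
          f 0 * ((x : ℂ) + 1) ^ (1 - 2 * ((σ : ℂ) + (τ : ℂ) * Complex.I)) /
          (2 * ((σ : ℂ) + (τ : ℂ) * Complex.I) - 1)) atTop (𝓝 0)) →
      ¬ (‖Λ a‖ = 1 ∧ ‖Λ b‖ = 1) := by
  intro τ hτ a b ha hab hsum Λ hΛ heig
  exact hU τ hτ a b ha hab (by linarith) Λ hΛ heig

/-- The filed crux `UnitCircleCrossedOnce` implies its mixed form W1 (`Λ a = 1` gives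
`‖Λ a‖ = 1`). [folklore] -/
theorem mayerPairing_exactLeft_of_unitCircleCrossedOnce (hU : UnitCircleCrossedOnce) :
    ∀ τ : ℝ, 7 ≤ |τ| → ∀ a b : ℝ, 0 < a → a < b → b < 1 / 2 → ∀ Λ : ℝ → ℂ,
      ContinuousOn Λ (Set.Icc a b) →
      (∀ σ ∈ Set.Icc a b, ∃ f : ℂ → ℂ, ∃ δ : ℝ, 0 < δ ∧ DifferentiableOn ℂ f {z : ℂ | -δ < z.re} ∧
        (∃ z : ℂ, 0 < z.re ∧ f z ≠ 0) ∧
        (∀ z : ℂ, -δ < z.re → Λ σ * (f z - f (z + 1)) =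
          (z + 1) ^ (-(2 * ((σ : ℂ) + (τ : ℂ) * Complex.I))) * f (1 / (z + 1))) ∧
        Tendsto (fun x : ℝ => Λ σ * f x -
          f 0 * ((x : ℂ) + 1) ^ (1 - 2 * ((σ : ℂ) + (τ : ℂ) * Complex.I)) /
          (2 * ((σ : ℂ) + (τ : ℂ) * Complex.I) - 1)) atTop (𝓝 0)) →
      ¬ (Λ a = 1 ∧ ‖Λ b‖ = 1) := by
  intro τ hτ a b ha hab hb Λ hΛ heig hone
  exact hU τ hτ a b ha hab hb Λ hΛ heig ⟨by rw [hone.1, norm_one], hone.2⟩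

/-- **The symmetric-interval modulus form W2 closes the route with the pairing crux.**
[folklore] -/
theorem mayerPairing_riemannHypothesis_of_symmetricModulus
    (h : ∀ τ : ℝ, 7 ≤ |τ| → ∀ a b : ℝ, 0 < a → a < b → a + b = 1 / 2 → ∀ Λ : ℝ → ℂ,
      ContinuousOn Λ (Set.Icc a b) →
      (∀ σ ∈ Set.Icc a b, ∃ f : ℂ → ℂ, ∃ δ : ℝ, 0 < δ ∧ DifferentiableOn ℂ f {z : ℂ | -δ < z.re} ∧
        (∃ z : ℂ, 0 < z.re ∧ f z ≠ 0) ∧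
        (∀ z : ℂ, -δ < z.re → Λ σ * (f z - f (z + 1)) =
          (z + 1) ^ (-(2 * ((σ : ℂ) + (τ : ℂ) * Complex.I))) * f (1 / (z + 1))) ∧
        Tendsto (fun x : ℝ => Λ σ * f x -
          f 0 * ((x : ℂ) + 1) ^ (1 - 2 * ((σ : ℂ) + (τ : ℂ) * Complex.I)) /
          (2 * ((σ : ℂ) + (τ : ℂ) * Complex.I) - 1)) atTop (𝓝 0)) →
      ¬ (‖Λ a‖ = 1 ∧ ‖Λ b‖ = 1))
    (hB : BranchPairing) : _root_.Summit.RiemannHypothesis :=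
  mayerPairing_riemannHypothesis_of_symmetricEndpointOne
    (mayerPairing_symmetricEndpointOne_of_symmetricModulus h) hB

/-- **The mixed form W1 closes the route with the pairing crux.** [folklore] -/
theorem mayerPairing_riemannHypothesis_of_exactLeft
    (h : ∀ τ : ℝ, 7 ≤ |τ| → ∀ a b : ℝ, 0 < a → a < b → b < 1 / 2 → ∀ Λ : ℝ → ℂ,
      ContinuousOn Λ (Set.Icc a b) →
      (∀ σ ∈ Set.Icc a b, ∃ f : ℂ → ℂ, ∃ δ : ℝ, 0 < δ ∧ DifferentiableOn ℂ f {z : ℂ | -δ < z.re} ∧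
        (∃ z : ℂ, 0 < z.re ∧ f z ≠ 0) ∧
        (∀ z : ℂ, -δ < z.re → Λ σ * (f z - f (z + 1)) =
          (z + 1) ^ (-(2 * ((σ : ℂ) + (τ : ℂ) * Complex.I))) * f (1 / (z + 1))) ∧
        Tendsto (fun x : ℝ => Λ σ * f x -
          f 0 * ((x : ℂ) + 1) ^ (1 - 2 * ((σ : ℂ) + (τ : ℂ) * Complex.I)) /
          (2 * ((σ : ℂ) + (τ : ℂ) * Complex.I) - 1)) atTop (𝓝 0)) →
      ¬ (Λ a = 1 ∧ ‖Λ b‖ = 1))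
    (hB : BranchPairing) : _root_.Summit.RiemannHypothesis :=
  mayerPairing_riemannHypothesis_of_symmetricEndpointOne
    (mayerPairing_symmetricEndpointOne_of_exactLeft h) hB


/-- **Mirror mixed form ⇒ endpoint form.** If no continuous eigenvalue selection on any
`[a, b] ⊂ (0, 1/2)` has MODULUS `1` at `a` and ENDS at the exact eigenvalue `1` at `b` (form W1′, the
mirror image of W1: "the branch arriving at the eigenvalue `1` was not on the unit circle further
left"), then the symmetric endpoint form W4sym holds. [folklore] -/
theorem mayerPairing_symmetricEndpointOne_of_exactRight
    (h : ∀ τ : ℝ, 7 ≤ |τ| → ∀ a b : ℝ, 0 < a → a < b → b < 1 / 2 → ∀ Λ : ℝ → ℂ,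
      ContinuousOn Λ (Set.Icc a b) →
      (∀ σ ∈ Set.Icc a b, ∃ f : ℂ → ℂ, ∃ δ : ℝ, 0 < δ ∧ DifferentiableOn ℂ f {z : ℂ | -δ < z.re} ∧
        (∃ z : ℂ, 0 < z.re ∧ f z ≠ 0) ∧
        (∀ z : ℂ, -δ < z.re → Λ σ * (f z - f (z + 1)) =
          (z + 1) ^ (-(2 * ((σ : ℂ) + (τ : ℂ) * Complex.I))) * f (1 / (z + 1))) ∧
        Tendsto (fun x : ℝ => Λ σ * f x -
          f 0 * ((x : ℂ) + 1) ^ (1 - 2 * ((σ : ℂ) + (τ : ℂ) * Complex.I)) /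
          (2 * ((σ : ℂ) + (τ : ℂ) * Complex.I) - 1)) atTop (𝓝 0)) →
      ¬ (‖Λ a‖ = 1 ∧ Λ b = 1)) :
    ∀ τ : ℝ, 7 ≤ |τ| → ∀ a b : ℝ, 0 < a → a < b → a + b = 1 / 2 → ∀ Λ : ℝ → ℂ,
      ContinuousOn Λ (Set.Icc a b) →
      (∀ σ ∈ Set.Icc a b, ∃ f : ℂ → ℂ, ∃ δ : ℝ, 0 < δ ∧ DifferentiableOn ℂ f {z : ℂ | -δ < z.re} ∧
        (∃ z : ℂ, 0 < z.re ∧ f z ≠ 0) ∧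
        (∀ z : ℂ, -δ < z.re → Λ σ * (f z - f (z + 1)) =
          (z + 1) ^ (-(2 * ((σ : ℂ) + (τ : ℂ) * Complex.I))) * f (1 / (z + 1))) ∧
        Tendsto (fun x : ℝ => Λ σ * f x -
          f 0 * ((x : ℂ) + 1) ^ (1 - 2 * ((σ : ℂ) + (τ : ℂ) * Complex.I)) /
          (2 * ((σ : ℂ) + (τ : ℂ) * Complex.I) - 1)) atTop (𝓝 0)) →
      ¬ (Λ a = 1 ∧ Λ b = 1) := by
  intro τ hτ a b ha hab hsum Λ hΛ heig hone
  exact h τ hτ a b ha hab (by linarith) Λ hΛ heig ⟨by rw [hone.1, norm_one], hone.2⟩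

/-- The filed crux `UnitCircleCrossedOnce` implies its mirror mixed form W1′ (`Λ b = 1` gives
`‖Λ b‖ = 1`). [folklore] -/
theorem mayerPairing_exactRight_of_unitCircleCrossedOnce (hU : UnitCircleCrossedOnce) :
    ∀ τ : ℝ, 7 ≤ |τ| → ∀ a b : ℝ, 0 < a → a < b → b < 1 / 2 → ∀ Λ : ℝ → ℂ,
      ContinuousOn Λ (Set.Icc a b) →
      (∀ σ ∈ Set.Icc a b, ∃ f : ℂ → ℂ, ∃ δ : ℝ, 0 < δ ∧ DifferentiableOn ℂ f {z : ℂ | -δ < z.re} ∧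
        (∃ z : ℂ, 0 < z.re ∧ f z ≠ 0) ∧
        (∀ z : ℂ, -δ < z.re → Λ σ * (f z - f (z + 1)) =
          (z + 1) ^ (-(2 * ((σ : ℂ) + (τ : ℂ) * Complex.I))) * f (1 / (z + 1))) ∧
        Tendsto (fun x : ℝ => Λ σ * f x -
          f 0 * ((x : ℂ) + 1) ^ (1 - 2 * ((σ : ℂ) + (τ : ℂ) * Complex.I)) /
          (2 * ((σ : ℂ) + (τ : ℂ) * Complex.I) - 1)) atTop (𝓝 0)) →
      ¬ (‖Λ a‖ = 1 ∧ Λ b = 1) := by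
  intro τ hτ a b ha hab hb Λ hΛ heig hone
  exact hU τ hτ a b ha hab hb Λ hΛ heig ⟨hone.1, by rw [hone.2, norm_one]⟩

/-- **The mirror mixed form W1′ closes the route with the pairing crux.** [folklore] -/
theorem mayerPairing_riemannHypothesis_of_exactRight
    (h : ∀ τ : ℝ, 7 ≤ |τ| → ∀ a b : ℝ, 0 < a → a < b → b < 1 / 2 → ∀ Λ : ℝ → ℂ,
      ContinuousOn Λ (Set.Icc a b) →
      (∀ σ ∈ Set.Icc a b, ∃ f : ℂ → ℂ, ∃ δ : ℝ, 0 < δ ∧ DifferentiableOn ℂ f {z : ℂ | -δ < z.re} ∧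
        (∃ z : ℂ, 0 < z.re ∧ f z ≠ 0) ∧
        (∀ z : ℂ, -δ < z.re → Λ σ * (f z - f (z + 1)) =
          (z + 1) ^ (-(2 * ((σ : ℂ) + (τ : ℂ) * Complex.I))) * f (1 / (z + 1))) ∧
        Tendsto (fun x : ℝ => Λ σ * f x -
          f 0 * ((x : ℂ) + 1) ^ (1 - 2 * ((σ : ℂ) + (τ : ℂ) * Complex.I)) /
          (2 * ((σ : ℂ) + (τ : ℂ) * Complex.I) - 1)) atTop (𝓝 0)) →
      ¬ (‖Λ a‖ = 1 ∧ Λ b = 1))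
    (hB : BranchPairing) : _root_.Summit.RiemannHypothesis :=
  mayerPairing_riemannHypothesis_of_symmetricEndpointOne
    (mayerPairing_symmetricEndpointOne_of_exactRight h) hB

end Summit.RiemannHypothesis.RiemannHypothesis.Theorems
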